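import Literature.Probability.Percolation.ArmSeparationExtSlotEvents
import Literature.Probability.Percolation.ArmSeparationSlotProb
import HarnessLib

/-!
# Outer slots: the corridors have probability bounded below

Topic: Probability / Percolation; family `crit-perc`. A brick of the discharge of
`Literature.Probability.Percolation.Nolin2008_twoArm_separation` (Nolin 2008, Thm. 11
[arXiv 0711.4948: Thm. 10]; `ArmSeparation.lean`), landing of the EXTERNAL extremities (mirror of
`ArmSeparationSlotProb.lean`): the corridor event `extCorrEvent` of an outer slot (spoke, arc of a
thin ring, approach tube, connector band, fence line, thinned outer free space — all increasing
and open the prescribed way) has probability at least `c^(len + 5)`, `c` the RSW constant at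
aspect ratio `ρ` (`real_extCorrEvent_ge`: RSW in each tube, `Tube.le_real_event`,
`Tube.pow_le_real_eventAll`, and Harris' inequality five times), and the corridor of the closed
arm has the same bound (`ESlot.real_whiteCorr_eq`, `negFlip`-invariance of `P_{1/2}`).

## References

* P. Nolin, *Near-critical percolation in two dimensions*, Electron. J. Probab. 13 (2008), §4.3
  Prop. 12 (proof: "RSW in each tube, FKG") [arXiv 0711.4948: Prop. 11]. [Nolin2008]
-/

noncomputable section

open Set MeasureTheory

namespace Literature.Probability.Percolation

open LatticeModels Tube

/-- The approach tube as a tube event. [folklore] -/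
theorem extE2_eq_event (r e : ℕ) (t : ℤ) (W : ℕ) : extE2 r e t W = (⟨(r : ℤ) - e - 1, t, W, r / 64, true⟩ : Tube).event := rfl

/-- The connector band as a tube event. [folklore] -/
theorem extE3_eq_event (N H : ℕ) :
    extE3 N H = (⟨(N : ℤ) - (N / 8 : ℕ), -((N / 2 : ℕ) : ℤ) - (N / 64 : ℕ), N / 8 - 1, H, false⟩ : Tube).event := rfl

/-- The fence-line crossing as a tube event. [folklore] -/
theorem extE4_eq_event (N : ℕ) :
    extE4 N = (⟨(N : ℤ) - (N / 8 : ℕ), -((N / 2 : ℕ) : ℤ) - (N / 64 : ℕ) + 1, 2 * (N / 8) - 1, N / 64 - 1, true⟩ : Tube).event := rfl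

/-- The thinned outer free space as a tube event. [folklore] -/
theorem extE5_eq_event (N : ℕ) :
    extE5 N = (⟨(N : ℤ) + 2, -((N / 2 : ℕ) : ℤ) - (N / 64 : ℕ), N / 8 - 3, 2 * (N / 64), false⟩ : Tube).event := rfl

/-- **The corridor event has probability at least `c^(len + 5)`**: if `c ≤ P_{1/2}(long-way
crossing of [0, ρ q] × [0, q])` for all `q` (`ρ ≥ 32`), the spoke has aspect `L ≤ ρ · 2ε`, the ring
tubes have aspect `≤ 4`, the approach tube `W ≤ ρ (r/64)`, the connector band `H ≤ ρ (N/8 - 1)`,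
the fence line and free space fit (`N ≥ 512`), and the arc has at most `len` tubes. [cite: Nolin2008, §4.3 Prop. 12 (proof) (arXiv 0711.4948: Prop. 11)] -/
theorem real_extCorrEvent_ge {c : ℝ} {ρ : ℕ}
    (hrsw : ∀ q : ℕ, 1 ≤ ⌊(ρ : ℝ) * q⌋₊ → c ≤ triLRCrossingProb half ⌊(ρ : ℝ) * q⌋₊ q) (hρ : 32 ≤ ρ) (hc : 0 ≤ c)
    {i M N k : ℕ} {T₀ : ℤ} {w L ε r e s a len : ℕ} {t : ℤ} {W H : ℕ}
    (hε : 1 ≤ ε) (hsp : L ≤ ρ * (2 * ε)) (he : 1 ≤ e) (hse : s + 2 * e ≤ 4 * (2 * e))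
    (hr : 1 ≤ r / 64) (hW : W ≤ ρ * (r / 64)) (hH : H ≤ ρ * (N / 8 - 1)) (hN : 512 ≤ N)
    (hlen : (arc (thinRing r e s) a len).length ≤ len) :
    c ^ (len + 5) ≤ (triSitePercolation half).real (extCorrEvent i M N k T₀ w L ε r e s a len t W H) := by
  have hρ1 : 1 ≤ ρ := le_trans (by norm_num) hρ
  have hρ4 : 4 ≤ ρ := le_trans (by norm_num) hρ
  have hc1 : c ≤ 1 := by
    have h := hrsw 1 (by rw [Nat.cast_one, mul_one, Nat.floor_natCast]; exact hρ1)
    exact h.trans measureReal_le_one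
  -- the six events, their supports and monotonicity
  set E1 := extSpokeEvent i M k T₀ w L ε with hE1
  set E2 := eventAll (arc (thinRing r e s) a len) with hE2
  set E3 := extE2 r e t W with hE3
  set E4 := extE3 N H with hE4
  set E5 := extE4 N with hE5
  set E6 := extE5 N with hE6
  set S1 : Finset (Site 2) := (extSpokeTube M k T₀ w L ε).sites.image (triRotIsoPow i) with hS1
  set S2 : Finset (Site 2) := sitesAll (arc (thinRing r e s) a len) with hS2
  set S3 : Finset (Site 2) := triStripFinset ((r : ℤ) - e - 1) t W (r / 64) with hS3
  set S4 : Finset (Site 2) := triStripFinset ((N : ℤ) - (N / 8 : ℕ)) (-((N / 2 : ℕ) : ℤ) - (N / 64 : ℕ)) (N / 8 - 1) H with hS4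
  set S5 : Finset (Site 2) := triStripFinset ((N : ℤ) - (N / 8 : ℕ)) (-((N / 2 : ℕ) : ℤ) - (N / 64 : ℕ) + 1) (2 * (N / 8) - 1) (N / 64 - 1)
    with hS5
  set S6 : Finset (Site 2) := triStripFinset ((N : ℤ) + 2) (-((N / 2 : ℕ) : ℤ) - (N / 64 : ℕ)) (N / 8 - 3) (2 * (N / 64)) with hS6
  have d1 : DeterminedBy E1 ↑S1 := by rw [hS1, Finset.coe_image, coe_sites]; exact determinedBy_extSpokeEvent i M k T₀ w L ε
  have d2 : DeterminedBy E2 ↑S2 := determinedBy_eventAll _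
  have d3 : DeterminedBy E3 ↑S3 := determinedBy_triHCross _ _ _ _
  have d4 : DeterminedBy E4 ↑S4 := determinedBy_triVCross _ _ _ _
  have d5 : DeterminedBy E5 ↑S5 := determinedBy_triHCross _ _ _ _
  have d6 : DeterminedBy E6 ↑S6 := determinedBy_triVCross _ _ _ _
  have u1 : IsUpperSet E1 := isUpperSet_extSpokeEvent i M k T₀ w L ε
  have u2 : IsUpperSet E2 := isUpperSet_eventAll _
  have u3 : IsUpperSet E3 := isUpperSet_triHCross _ _ _ _
  have u4 : IsUpperSet E4 := isUpperSet_triVCross _ _ _ _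
  have u5 : IsUpperSet E5 := isUpperSet_triHCross _ _ _ _
  have u6 : IsUpperSet E6 := isUpperSet_triVCross _ _ _ _
  -- the six probabilities
  have p1 : c ≤ (triSitePercolation half).real E1 := by
    rw [hE1, real_extSpokeEvent]
    refine Tube.le_real_event _ hrsw hρ1 ?_
    simp only [Tube.AspectLE, extSpokeTube, cond_true]
    exact ⟨hsp, by omega⟩
  have p2 : c ^ len ≤ (triSitePercolation half).real E2 := by
    refine le_trans (pow_le_pow_of_le_one hc hc1 hlen) ?_
    refine Tube.pow_le_real_eventAll hrsw hρ1 hc _ fun T hT => ?_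
    exact (aspectLE_of_mem_thinRing he hse (mem_of_mem_arc hT)).mono hρ4
  have p3 : c ≤ (triSitePercolation half).real E3 := by
    rw [hE3, extE2_eq_event]
    refine Tube.le_real_event _ hrsw hρ1 ?_
    simp only [Tube.AspectLE, cond_true]
    exact ⟨hW, hr⟩
  have p4 : c ≤ (triSitePercolation half).real E4 := by
    rw [hE4, extE3_eq_event]
    refine Tube.le_real_event _ hrsw hρ1 ?_
    simp only [Tube.AspectLE, cond_false]
    exact ⟨hH, by omega⟩
  have p5 : c ≤ (triSitePercolation half).real E5 := by
    rw [hE5, extE4_eq_event]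
    refine Tube.le_real_event _ hrsw hρ1 ?_
    simp only [Tube.AspectLE, cond_true]
    constructor
    · calc 2 * (N / 8) - 1 ≤ 32 * (N / 64 - 1) := by omega
        _ ≤ ρ * (N / 64 - 1) := Nat.mul_le_mul_right _ hρ
    · omega
  have p6 : c ≤ (triSitePercolation half).real E6 := by
    rw [hE6, extE5_eq_event]
    refine Tube.le_real_event _ hrsw hρ1 ?_
    simp only [Tube.AspectLE, cond_false]
    constructor
    · calc 2 * (N / 64) ≤ 1 * (N / 8 - 3) := by omega
        _ ≤ ρ * (N / 8 - 3) := Nat.mul_le_mul_right _ hρ1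
    · omega
  -- Harris, five times
  have h12 := sitePercolation_harris' half d1 d2 u1 u2
  have d12 : DeterminedBy (E1 ∩ E2) ↑(S1 ∪ S2) := by
    rw [Finset.coe_union]; exact (d1.mono subset_union_left).inter (d2.mono subset_union_right)
  have h123 := sitePercolation_harris' half d12 d3 (u1.inter u2) u3
  have d123 : DeterminedBy (E1 ∩ E2 ∩ E3) ↑(S1 ∪ S2 ∪ S3) := by
    rw [Finset.coe_union]; exact (d12.mono subset_union_left).inter (d3.mono subset_union_right)
  have h1234 := sitePercolation_harris' half d123 d4 ((u1.inter u2).inter u3) u4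
  have d1234 : DeterminedBy (E1 ∩ E2 ∩ E3 ∩ E4) ↑(S1 ∪ S2 ∪ S3 ∪ S4) := by
    rw [Finset.coe_union]; exact (d123.mono subset_union_left).inter (d4.mono subset_union_right)
  have h12345 := sitePercolation_harris' half d1234 d5 (((u1.inter u2).inter u3).inter u4) u5
  have d12345 : DeterminedBy (E1 ∩ E2 ∩ E3 ∩ E4 ∩ E5) ↑(S1 ∪ S2 ∪ S3 ∪ S4 ∪ S5) := by
    rw [Finset.coe_union]; exact (d1234.mono subset_union_left).inter (d5.mono subset_union_right)
  have h123456 := sitePercolation_harris' half d12345 d6 ((((u1.inter u2).inter u3).inter u4).inter u5) u6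
  have hnn : ∀ A : Set (SiteConfig (Site 2)), 0 ≤ (sitePercolation (Site 2) half).real A := fun A => measureReal_nonneg
  unfold triSitePercolation at p1 p2 p3 p4 p5 p6 ⊢
  unfold extCorrEvent
  rw [← hE1, ← hE2, ← hE3, ← hE4, ← hE5, ← hE6]
  calc c ^ (len + 5) = c * c ^ len * c * c * c * c := by ring
    _ ≤ (sitePercolation (Site 2) half).real E1 * (sitePercolation (Site 2) half).real E2 *
        (sitePercolation (Site 2) half).real E3 * (sitePercolation (Site 2) half).real E4 * (sitePercolation (Site 2) half).real E5 *
        (sitePercolation (Site 2) half).real E6 := by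
      gcongr
    _ ≤ (sitePercolation (Site 2) half).real (E1 ∩ E2 ∩ E3 ∩ E4 ∩ E5 ∩ E6) := by
      calc _ ≤ (sitePercolation (Site 2) half).real (E1 ∩ E2) * (sitePercolation (Site 2) half).real E3 *
            (sitePercolation (Site 2) half).real E4 * (sitePercolation (Site 2) half).real E5 *
            (sitePercolation (Site 2) half).real E6 := by gcongr
        _ ≤ (sitePercolation (Site 2) half).real (E1 ∩ E2 ∩ E3) * (sitePercolation (Site 2) half).real E4 *
            (sitePercolation (Site 2) half).real E5 * (sitePercolation (Site 2) half).real E6 := by gcongr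
        _ ≤ (sitePercolation (Site 2) half).real (E1 ∩ E2 ∩ E3 ∩ E4) * (sitePercolation (Site 2) half).real E5 *
            (sitePercolation (Site 2) half).real E6 := by gcongr
        _ ≤ (sitePercolation (Site 2) half).real (E1 ∩ E2 ∩ E3 ∩ E4 ∩ E5) * (sitePercolation (Site 2) half).real E6 := by gcongr
        _ ≤ _ := h123456

namespace ESlot

/-- **The corridor of the closed arm has the same probability bound** (`P_{1/2}` is `negFlip`-invariant). [folklore] -/
theorem real_whiteCorr_eq (P : EParams) (σ : ESlot) :
    (triSitePercolation half).real (σ.whiteCorr P) = (triSitePercolation half).real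
      (extCorrEvent σ.ic' P.M P.N (σ.kc P) (σ.Tc P) (σ.wc P) (P.LW - σ.kc P) P.ε P.rW P.e P.s (σ.aW P) (σ.lenW P) (σ.tgc P)
        P.WW (σ.HW P)) :=
  triSitePercolation_real_preimage_negFlip _

end ESlot

end Literature.Probability.Percolation
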